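import Summits.QuantumFields.YangMills.Theorems.BalabanUVNodesN19BudgetRoadAtRecord11
import Summits.QuantumFields.YangMills.Theorems.BalabanUVNodesSpineCarriersOfRecord11
import Summits.QuantumFields.YangMills.Theorems.BalabanUVNodesN27AtRecordK4
import Literature.MathematicalPhysics.QuantumFieldTheory.Balaban1983to89.T4MatchingDegenerate

/-!
# YM-DAG node N19 (= NE7 proper) AT THE SPINE-CARRIER HOME OF RECORD `YMDAG.UVSplit.SRec₁₁ cr` — the knit `Spine.NE7.Core →
# HybridNE7.matchingModConstants` INSTANTIATED at the Stage-11 spine-carrier predicate KEYED by a reading `cr` (n20-e's (T-SPINE) home, p454411),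
# N19's own binders KEYED at NODE 00's tuples, `summable_deltaOfRecord` DISPLAYED content-free at the home

Cell `pub-ymgap`, HUMAN RULING D-0062 (Track A), R134 acceleration seat `pub-ymgap-dag-n19-d` (s2 = BY-NAME KNIT at the ₁₁ record; director-ym R134 row
«knit `Spine.NE7.Core` → `HybridNE7.matchingModConstants` :183 at spine carriers ₁₁ with `summable_deltaOfRecord` displayed honestly»), module 4 = the
lineage's trigger (t1) «the `SRec₁₁` home lands ⇒ ONE-APPLICATION instances of modules 1–3 at it» (`BalabanUVNodesN19TargetAtRecord11` p450178 ✓ ·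
`…Currency` p451683 ✓ · `BalabanUVNodesN19BudgetRoadAtRecord11` p453367 ✓).  `--supports stmt-QuantumFields-19676` (K3 «SpineGivenEndpointR11»).
COUNT-NEUTRAL; NOT a discharge claim; THEOREMS ONLY, 0 `def`, 0 `sorry`; restate-immune (route file not imported; the target is stated in the Literature
name `T4ApexVariance.MatchingUnder D END` = `D.UnderHypotheses END (g₀ ↦ StringwiseMatching (D.scheme g₀))`).

THE HOME.  `SRec₁₁ cr` (`BalabanUVNodesSpineCarriersOfRecord11`, dag-n20-e, p454411 ✓ 9dfa66f0dce1) pins at `(F, D, g₀, os)` exactly the bundles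
`cr F θ hP g₀ os` of the ADMISSIBLE Stage-11 tuples `θ` WITH PROVISOS `hP` whose datum of record IS `D`; the reading `cr : SpineReading₁₁ N` is a
PARAMETER (WORDS-99∕101: no reading of Bałaban's dressed two-run expansion off the record exists today).  Modules 1–3 are parametric in `SRec`; THIS
module sets `SRec := SRec₁₁ cr` and re-keys N19's OWN binders (∃δ-edge, U4′'s budget half, the interim pin `S.δ = deltaOfRecord …`, the rate edge, the
term-budget reading) at the tuples — «for every admissible `θ` with provisos, every `g₀`, `os`: … at `cr F θ hP g₀ os`» — the sibling stubs `S_N27x` ·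
`S_N20` · `S_N21` staying NAMED PROPS at `SRec₁₁ cr` (keyed producers: n20-e's `s_N27x_sRec₁₁_of` ∕ `s_N20_sRec₁₁_iff` ∕ `s_N21_sRec₁₁_iff`).

WHAT IS KERNEL-CHECKED ([bookkeeping] over tree theorems BY NAME).
* §1 KEYED FACES at `SRec₁₁ cr` (`↔`; `sRec₁₁_self` one way, `rintro ⟨θ, hP, hθ, rfl, rfl⟩` the other): `forall_sRec₁₁_iff` (master face) ·
  `lt_one_sRec₁₁_iff` · `coreEdge_sRec₁₁_iff` (module 1's `hedge`, `Inputs` read AT THE DATUM) · `rateEdge_sRec₁₁_iff` (module 1's `hedgeR` for a rate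
  predicate `RRec` — HONEST DISPLAY of node00-def-RR-2's located point, INBOX l.12307: `R` ranges over EVERYTHING `RRec` pins at θ's datum, NOT «the rate
  carriers of θ's run»; the coherent pairing at BOTH homes is module 5 `BalabanUVNodesN19TargetAtHomes11`).
* §1′ THE HONEST DISPLAY AT THE HOME (referee pin [DAGREFB-G4-PIN-N19-DELTAOFRECORD-JUNK-VALUE], INBOX l.10444), UNDER THE PIN:
  `s_U4_sRec₁₁_iff_lt_one_of_pin` (U4′ at `SRec₁₁ cr` IS its budget half ALONE — the δ-half is `summable_deltaOfRecord`, TRUE BY CONSTRUCTION) ·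
  `s_N19_sRec₁₁_iff_coreEdge_of_pin` (the K5 stub `S_N19 (SRec₁₁ cr) Inputs` IS the keyed ∃δ-edge, no more, no less) · `hybridNE7_at_sRec₁₁_of_pin` (node
  U5's `T4MatchingAssembly.HybridNE7` :146 FIELD BY FIELD at every pinned bundle carrying `Inputs`: `weight := S_N20`, `shell := S_N21`, `lt_one :=` keyed
  budget half, `summable := summable_deltaOfRecord` — DISPLAYED, never progress —, `core := S_N19`).
* §2 N19's DECL TARGET AT THE HOME — node U5's exit (:183) along every Stage-11 record's Wilson schemes, ONE APPLICATION each: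
  `matching_at_record₁₁_sRec₁₁_of_coreEdge` (`∃ l₀ vol δ′, 0 < l₀ ∧ Summable δ′ ∧ T4CauchySum.MatchingModConstants vol l₀ δ′ (schemeZ (D.scheme g₀) os)`
  under the prefix at every `Node00.IsRecordOfRecord₁₁C F N D w`, guarded by `Inputs`) · `matchingUnder_at_record₁₁_sRec₁₁_of_spineRates` (K4 consumed) ·
  `matchingUnder_at_record₁₁_sRec₁₁_of_rateStubs_tail` (module 2's seven rate stubs at a PARAMETRIC `RRec` + the keyed rate edge; no budget half:
  n27-a XIV `spine_of_rateStubs_coreEdge` ∘ n23-b `T4MatchingDegenerate.hybridNE7Under_iff_matchingUnder`).  The instance at the (T-RATE) home `RRec₁₁ 𝔯`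
  (dag-n22-e, p457330) with the CANONICAL spine reading — the same-key pairing — is module 5 `BalabanUVNodesN19TargetAtHomes11`.
* §3 `matchingUnder_at_record₁₁_sRec₁₁_of_termBudget` — module 3's budget road with the per-term budget READ AT THE TUPLES, K4 consumed.

HONEST FRAMING.  Kernel bookkeeping over hypothesis SHAPES; 0 `def`, 0 `sorry`, standard axioms.  NE7 is NOT PRINTED for the d = 4 procedure and NOT
PROVED; `cr`, every keyed binder, the sibling stubs N27x ∕ N20 ∕ N21, the rate stubs at `RRec`, K4's hook are HYPOTHESES ∕ PARAMETERS — 0∕1 today (no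
`cr` of record: dag-n20-e LOCATED (F1)–(F4), INBOX l.≈12300); the prefix-free keyed clauses ask the estimates at EVERY bare `g₀` (off the tuned runs the
reading may be junk — the definer's freedom); inhabitation of ₁₁C is K0 (open); nothing of Bałaban's is asserted or instantiated; N19 NOT discharged;
Track A count unmoved (5∕27).  One finite four-torus at fixed ε, rung (B)+1 — NOT infinite volume, NOT OS on ℝ⁴, NOT a mass gap, NOT Clay.  No cite tags.
-/

set_option autoImplicit false

noncomputable section

open Finset

namespace Summit.QuantumFields.YangMills.BalabanUVNodes.N19TargetAtRecord11Home

open Literature.MathematicalPhysics.QuantumFieldTheory.Balaban1983to89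
open Literature.MathematicalPhysics.QuantumFieldTheory.Balaban1983to89.T4Continuum
open T4WeightBudget (RelWeightBound)
open T4IndicatorShell (ShellWeightBound)
open T4GoodClassBudget (TermBudget)
open T4MatchingAssembly (HybridNE7)
open T4CauchySum (MatchingModConstants)
open T4ContinuumYM4Torus (ForSmallCouplings)
open T4ApexVariance (MatchingUnder)
open Summit.QuantumFields.BalabanUV.T4Continuum.Spine
open Summit.QuantumFields.YangMills.BalabanUVNodes.N19AtSpineCarriers (deltaOfRecord summable_deltaOfRecord core_deltaOfRecord)
open Summit.QuantumFields.YangMills.BalabanUVNodes.N19TargetAtRecord11 (avgMeasurable_of_isRecordOfRecord₁₁C matching_at_record₁₁_of_coreEdge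
  stringwiseMatching_at_record₁₁_of_spineRates stringwiseMatching_at_record₁₁_of_rateStubs)
open Summit.QuantumFields.YangMills.BalabanUVNodes.N19BudgetRoadAtRecord11 (matchingUnder_at_record₁₁_of_termBudgetReading)
open Summit.QuantumFields.YangMills.Theorems.BalabanUVNodesN27SpineRecord (spine_of_rateStubs_coreEdge)
open YMDAG.UVSplit (Datum SpineCarriers SpineRecordPred InputsPred RateCarriers RateRecordPred RatesAt RateInputs Spine S_N27x S_N20 S_N21
  S_N19 S_U4 SpineRates S_R00x S_N14 S_N15 S_N16 S_N17 S_N18 S_N22 SpineReading₁₁ SRec₁₁ sRec₁₁_iff sRec₁₁_self s_N19_sRec₁₁_iff s_U4_sRec₁₁_iff)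
open Node00 (Stage11Params datumOfRecord₁₁ IsRecordOfRecord₁₁C)

variable {N : ℕ} [NeZero N] (cr : SpineReading₁₁ N)

/-! ## §1 The keyed faces of N19's binders at the home `SRec₁₁ cr` -/

section Faces
/-- **MASTER FACE** [bookkeeping]: a clause `P` quantified over the bundles `SRec₁₁ cr` pins IS the clause at the reading `cr F θ hP g₀ os` over the
admissible Stage-11 tuples with provisos, at their data of record (`sRec₁₁_self` ∕ the datum clause). [folklore] -/
theorem forall_sRec₁₁_iff (P : (F : T4Family) → Datum F N → (ℕ → ℝ) → List (ULoop F) → SpineCarriers → Prop) :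
    (∀ (F : T4Family) (D : Datum F N) (g₀ : ℕ → ℝ) (os : List (ULoop F)) (S : SpineCarriers), SRec₁₁ cr F D g₀ os S → P F D g₀ os S) ↔
      ∀ (F : T4Family) (θ : Stage11Params F N) (hP : θ.Provisos₁₁), θ.Admissible → ∀ (g₀ : ℕ → ℝ) (os : List (ULoop F)),
        P F (datumOfRecord₁₁ F N θ hP) g₀ os (cr F θ hP g₀ os) := by
  constructor
  · intro h F θ hP hθ g₀ os
    exact h F _ g₀ os _ (sRec₁₁_self cr θ hP hθ g₀ os)
  · rintro h F D g₀ os S ⟨θ, hP, hθ, rfl, rfl⟩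
    exact h F θ hP hθ g₀ os

/-- **U4′'s BUDGET HALF AT THE HOME** [bookkeeping]: module 1's binder `hlt` at `SRec₁₁ cr` ⟺ «for every admissible Stage-11 θ with provisos, every `g₀`,
`os`, `K`: `W K + Wsh K < 1` at `cr F θ hP g₀ os`». [folklore] -/
theorem lt_one_sRec₁₁_iff :
    (∀ (F : T4Family) (D : Datum F N) (g₀ : ℕ → ℝ) (os : List (ULoop F)) (S : SpineCarriers),
        SRec₁₁ cr F D g₀ os S → ∀ K, S.W K + S.Wsh K < 1) ↔
      ∀ (F : T4Family) (θ : Stage11Params F N) (hP : θ.Provisos₁₁), θ.Admissible → ∀ (g₀ : ℕ → ℝ) (os : List (ULoop F)) (K : ℕ),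
        (cr F θ hP g₀ os).W K + (cr F θ hP g₀ os).Wsh K < 1 :=
  forall_sRec₁₁_iff cr fun _ _ _ _ S => ∀ K, S.W K + S.Wsh K < 1

/-- **N19's ∃δ-EDGE AT THE HOME** [bookkeeping]: module 1's binder `hedge` at `SRec₁₁ cr` ⟺ «for every admissible Stage-11 θ with provisos, every `g₀`,
`os`: K4's conclusion `Inputs` READ AT THE DATUM `datumOfRecord₁₁ F N θ hP` gives SOME summable `δ` carrying `Spine.NE7.Core` on the shell-free cores of
`cr F θ hP g₀ os`».  (Compare n20-e's `s_N19_sRec₁₁_iff`: the K5 stub `S_N19` puts Core at the reading's OWN `δ`; §1′ relates the two under the pin.)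
[folklore] -/
theorem coreEdge_sRec₁₁_iff (Inputs : InputsPred N) :
    (∀ (F : T4Family) (D : Datum F N) (g₀ : ℕ → ℝ) (os : List (ULoop F)) (S : SpineCarriers),
        SRec₁₁ cr F D g₀ os S → Inputs F D g₀ os → letI := S.dec
        ∃ δ : ℕ → ℝ, NE7.Core S.l₀ S.vol S.T S.Bad (fun K t τ => S.A K t τ - S.shA K t τ)
          (fun K t τ => S.B K t τ - S.shB K t τ) δ ∧ Summable δ) ↔
      ∀ (F : T4Family) (θ : Stage11Params F N) (hP : θ.Provisos₁₁), θ.Admissible → ∀ (g₀ : ℕ → ℝ) (os : List (ULoop F)),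
        Inputs F (datumOfRecord₁₁ F N θ hP) g₀ os → letI := (cr F θ hP g₀ os).dec
        ∃ δ : ℕ → ℝ, NE7.Core (cr F θ hP g₀ os).l₀ (cr F θ hP g₀ os).vol (cr F θ hP g₀ os).T (cr F θ hP g₀ os).Bad
          (fun K t τ => (cr F θ hP g₀ os).A K t τ - (cr F θ hP g₀ os).shA K t τ)
          (fun K t τ => (cr F θ hP g₀ os).B K t τ - (cr F θ hP g₀ os).shB K t τ) δ ∧ Summable δ := by
  constructor
  · intro h F θ hP hθ g₀ os hI
    exact h F _ g₀ os _ (sRec₁₁_self cr θ hP hθ g₀ os) hI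
  · rintro h F D g₀ os S ⟨θ, hP, hθ, rfl, rfl⟩ hI
    exact h F θ hP hθ g₀ os hI

/-- **N19's RATE EDGE AT THE HOME, FOR A RATE-CARRIER PREDICATE `RRec`** [bookkeeping]: module 1's binder `hedgeR` at `SRec₁₁ cr` ⟺ «for every admissible
Stage-11 θ with provisos, every `g₀`, `os`, and EVERY rate-carrier bundle `R` that `RRec` pins AT θ's DATUM carrying the six in-edges (`RatesAt`): SOME
summable `δ` carries `Spine.NE7.Core` on the shell-free cores of `cr F θ hP g₀ os`».  HONEST DISPLAY (node00-def-RR-2's located point): `R` is NOT «the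
rate carriers of θ's run» — the datum does not determine the tuple; the (T-RATE) home `RRec₁₁ 𝔯` (dag-n22-e) hands the bundles read at the CANONICAL
parameter of θ's datum (module 5 `rateEdge_sRec₁₁_rRec₁₁_iff`); the same-key coupling is module 5's canonical pairing. [folklore] -/
theorem rateEdge_sRec₁₁_iff (RRec : RateRecordPred N) :
    (∀ (F : T4Family) (D : Datum F N) (g₀ : ℕ → ℝ) (os : List (ULoop F)) (S : SpineCarriers) (R : RateCarriers N),
        SRec₁₁ cr F D g₀ os S → RRec F D g₀ os R → RatesAt D R → letI := S.dec
        ∃ δ : ℕ → ℝ, NE7.Core S.l₀ S.vol S.T S.Bad (fun K t τ => S.A K t τ - S.shA K t τ)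
          (fun K t τ => S.B K t τ - S.shB K t τ) δ ∧ Summable δ) ↔
      ∀ (F : T4Family) (θ : Stage11Params F N) (hP : θ.Provisos₁₁), θ.Admissible → ∀ (g₀ : ℕ → ℝ) (os : List (ULoop F))
        (R : RateCarriers N), RRec F (datumOfRecord₁₁ F N θ hP) g₀ os R → RatesAt (datumOfRecord₁₁ F N θ hP) R →
        letI := (cr F θ hP g₀ os).dec
        ∃ δ : ℕ → ℝ, NE7.Core (cr F θ hP g₀ os).l₀ (cr F θ hP g₀ os).vol (cr F θ hP g₀ os).T (cr F θ hP g₀ os).Bad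
          (fun K t τ => (cr F θ hP g₀ os).A K t τ - (cr F θ hP g₀ os).shA K t τ)
          (fun K t τ => (cr F θ hP g₀ os).B K t τ - (cr F θ hP g₀ os).shB K t τ) δ ∧ Summable δ := by
  constructor
  · intro h F θ hP hθ g₀ os R hR hrates
    exact h F _ g₀ os _ R (sRec₁₁_self cr θ hP hθ g₀ os) hR hrates
  · rintro h F D g₀ os S R ⟨θ, hP, hθ, rfl, rfl⟩ hR hrates
    exact h F θ hP hθ g₀ os R hR hrates

end Faces

/-! ## §1′ The honest display at the home: UNDER THE PIN, U4′'s δ-half is content-free and `S_N19` IS the ∃δ-edge; `HybridNE7` field by field -/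

section Pin

variable (Inputs : InputsPred N)
/-- **U4′ AT THE HOME UNDER THE PIN IS ITS BUDGET HALF ALONE** [bookkeeping] (referee pin of record): if the reading fills its `δ`-slot with the
remainder of record, `S_U4 (SRec₁₁ cr)` ⟺ the keyed budget half «`W K + Wsh K < 1` at `cr F θ hP g₀ os`» — the δ-half `Summable (cr …).δ` being
`summable_deltaOfRecord`, TRUE BY CONSTRUCTION; never progress. [folklore] -/
theorem s_U4_sRec₁₁_iff_lt_one_of_pin
    (hpin : ∀ (F : T4Family) (θ : Stage11Params F N) (hP : θ.Provisos₁₁), θ.Admissible → ∀ (g₀ : ℕ → ℝ) (os : List (ULoop F)),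
      letI := (cr F θ hP g₀ os).dec
      (cr F θ hP g₀ os).δ = deltaOfRecord (cr F θ hP g₀ os).l₀ (cr F θ hP g₀ os).vol (cr F θ hP g₀ os).T (cr F θ hP g₀ os).Bad
        (fun K t τ => (cr F θ hP g₀ os).A K t τ - (cr F θ hP g₀ os).shA K t τ)
        (fun K t τ => (cr F θ hP g₀ os).B K t τ - (cr F θ hP g₀ os).shB K t τ)) :
    S_U4 (SRec₁₁ cr) ↔
      ∀ (F : T4Family) (θ : Stage11Params F N) (hP : θ.Provisos₁₁), θ.Admissible → ∀ (g₀ : ℕ → ℝ) (os : List (ULoop F)) (K : ℕ),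
        (cr F θ hP g₀ os).W K + (cr F θ hP g₀ os).Wsh K < 1 := by
  rw [s_U4_sRec₁₁_iff]
  refine ⟨fun h F θ hP hθ g₀ os => (h F θ hP hθ g₀ os).1, fun h F θ hP hθ g₀ os => ⟨h F θ hP hθ g₀ os, ?_⟩⟩
  letI := (cr F θ hP g₀ os).dec
  rw [hpin F θ hP hθ g₀ os]
  exact summable_deltaOfRecord

/-- **THE K5 STUB `S_N19` AT THE HOME UNDER THE PIN IS THE KEYED ∃δ-EDGE** [bookkeeping]: if the reading fills its `δ`-slot with the remainder of record,
`S_N19 (SRec₁₁ cr) Inputs` (Core at the reading's OWN `δ`, n20-e's `s_N19_sRec₁₁_iff`) ⟺ «for every admissible θ with provisos, every `g₀`, `os`: `Inputs`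
at the datum gives SOME summable `δ` with `Spine.NE7.Core` on the shell-free cores of `cr F θ hP g₀ os`» ((⇒) `δ := (cr …).δ`, summable by construction;
(⇐) the junction `core_deltaOfRecord`).  THE WHOLE N19 CONTENT IS THAT EDGE. [folklore] -/
theorem s_N19_sRec₁₁_iff_coreEdge_of_pin
    (hpin : ∀ (F : T4Family) (θ : Stage11Params F N) (hP : θ.Provisos₁₁), θ.Admissible → ∀ (g₀ : ℕ → ℝ) (os : List (ULoop F)),
      letI := (cr F θ hP g₀ os).dec
      (cr F θ hP g₀ os).δ = deltaOfRecord (cr F θ hP g₀ os).l₀ (cr F θ hP g₀ os).vol (cr F θ hP g₀ os).T (cr F θ hP g₀ os).Bad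
        (fun K t τ => (cr F θ hP g₀ os).A K t τ - (cr F θ hP g₀ os).shA K t τ)
        (fun K t τ => (cr F θ hP g₀ os).B K t τ - (cr F θ hP g₀ os).shB K t τ)) :
    S_N19 (SRec₁₁ cr) Inputs ↔
      ∀ (F : T4Family) (θ : Stage11Params F N) (hP : θ.Provisos₁₁), θ.Admissible → ∀ (g₀ : ℕ → ℝ) (os : List (ULoop F)),
        Inputs F (datumOfRecord₁₁ F N θ hP) g₀ os → letI := (cr F θ hP g₀ os).dec
        ∃ δ : ℕ → ℝ, NE7.Core (cr F θ hP g₀ os).l₀ (cr F θ hP g₀ os).vol (cr F θ hP g₀ os).T (cr F θ hP g₀ os).Bad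
          (fun K t τ => (cr F θ hP g₀ os).A K t τ - (cr F θ hP g₀ os).shA K t τ)
          (fun K t τ => (cr F θ hP g₀ os).B K t τ - (cr F θ hP g₀ os).shB K t τ) δ ∧ Summable δ := by
  rw [s_N19_sRec₁₁_iff]
  refine ⟨fun h F θ hP hθ g₀ os hI => ?_, fun h F θ hP hθ g₀ os hI => ?_⟩
  · letI := (cr F θ hP g₀ os).dec
    refine ⟨(cr F θ hP g₀ os).δ, h F θ hP hθ g₀ os hI, ?_⟩
    rw [hpin F θ hP hθ g₀ os]
    exact summable_deltaOfRecord
  · letI := (cr F θ hP g₀ os).dec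
    have hc := core_deltaOfRecord (h F θ hP hθ g₀ os hI)
    rw [← hpin F θ hP hθ g₀ os] at hc
    exact hc

/-- **`HybridNE7` FIELD BY FIELD AT THE HOME, UNDER THE PIN** [bookkeeping] — the director's row at the ₁₁ spine carriers: at every bundle `S` that
`SRec₁₁ cr` pins at `(F, D, g₀, os)` carrying K4's conclusion `Inputs F D g₀ os`, node U5's hybrid datum `T4MatchingAssembly.HybridNE7` (:146) AT THE
BUNDLE's OWN FIELDS is assembled as `weight := S_N20 (SRec₁₁ cr)` · `shell := S_N21 (SRec₁₁ cr)` · `lt_one :=` the keyed budget half · `summable :=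
summable_deltaOfRecord` (under the pin; CONTENT-FREE, DISPLAYED, never progress) · `core := S_N19 (SRec₁₁ cr) Inputs`.  Node U5's exit
`HybridNE7.matchingModConstants` (:183) then reads E1∕E2 and positivity — §2 at the record. [folklore] -/
theorem hybridNE7_at_sRec₁₁_of_pin
    (hpin : ∀ (F : T4Family) (θ : Stage11Params F N) (hP : θ.Provisos₁₁), θ.Admissible → ∀ (g₀ : ℕ → ℝ) (os : List (ULoop F)),
      letI := (cr F θ hP g₀ os).dec
      (cr F θ hP g₀ os).δ = deltaOfRecord (cr F θ hP g₀ os).l₀ (cr F θ hP g₀ os).vol (cr F θ hP g₀ os).T (cr F θ hP g₀ os).Bad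
        (fun K t τ => (cr F θ hP g₀ os).A K t τ - (cr F θ hP g₀ os).shA K t τ)
        (fun K t τ => (cr F θ hP g₀ os).B K t τ - (cr F θ hP g₀ os).shB K t τ))
    (h20 : S_N20 (SRec₁₁ cr)) (h21 : S_N21 (SRec₁₁ cr))
    (hlt : ∀ (F : T4Family) (θ : Stage11Params F N) (hP : θ.Provisos₁₁), θ.Admissible → ∀ (g₀ : ℕ → ℝ) (os : List (ULoop F)) (K : ℕ),
      (cr F θ hP g₀ os).W K + (cr F θ hP g₀ os).Wsh K < 1)
    (h19 : S_N19 (SRec₁₁ cr) Inputs)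
    {F : T4Family} {D : Datum F N} {g₀ : ℕ → ℝ} {os : List (ULoop F)} {S : SpineCarriers} (hS : SRec₁₁ cr F D g₀ os S)
    (hI : Inputs F D g₀ os) :
    letI := S.dec
    HybridNE7 S.l₀ S.vol S.T S.A S.B S.Bad S.W S.shA S.shB S.Wsh S.δ := by
  obtain ⟨θ, hP, hθ, rfl, rfl⟩ := hS
  letI := (cr F θ hP g₀ os).dec
  exact
    { weight := h20 F _ g₀ os _ (sRec₁₁_self cr θ hP hθ g₀ os)
      shell := h21 F _ g₀ os _ (sRec₁₁_self cr θ hP hθ g₀ os)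
      lt_one := hlt F θ hP hθ g₀ os
      summable := by
        rw [hpin F θ hP hθ g₀ os]
        exact summable_deltaOfRecord
      core := h19 F _ g₀ os _ (sRec₁₁_self cr θ hP hθ g₀ os) hI }

end Pin

/-! ## §2 N19's DECL target at the home: node U5's exit along every Stage-11 record's Wilson schemes -/

section Target

variable (Inputs : InputsPred N) (RRec : RateRecordPred N)
/-- **N19's DECL TARGET AT THE HOME, GUARDED BY K4's CONCLUSION** [bookkeeping] — ONE application of module 1's `matching_at_record₁₁_of_coreEdge` at
`SRec := SRec₁₁ cr`: the sibling stubs `S_N27x ₁₁C` · `S_N20` · `S_N21` at `SRec₁₁ cr` (named Props; keyed producers n20-e's `s_N27x_sRec₁₁_of` ∕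
`s_N20_sRec₁₁_iff` ∕ `s_N21_sRec₁₁_iff`), and N19's two binders KEYED AT THE TUPLES — the budget half `hlt` and the ∃δ-edge `hedge` (Inputs read at the
datum) — give, at every `Node00.IsRecordOfRecord₁₁C F N D w` with (B) and END, for all small-coupling tuned runs and every loop string carrying `Inputs`:
`∃ l₀ vol δ′, 0 < l₀ ∧ Summable δ′ ∧ T4CauchySum.MatchingModConstants vol l₀ δ′ (schemeZ (D.scheme g₀) os)`. [folklore] -/
theorem matching_at_record₁₁_sRec₁₁_of_coreEdge
    (hx : S_N27x (fun F D w => IsRecordOfRecord₁₁C F N D w) (SRec₁₁ cr)) (h20 : S_N20 (SRec₁₁ cr)) (h21 : S_N21 (SRec₁₁ cr))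
    (hlt : ∀ (F : T4Family) (θ : Stage11Params F N) (hP : θ.Provisos₁₁), θ.Admissible → ∀ (g₀ : ℕ → ℝ) (os : List (ULoop F)) (K : ℕ),
      (cr F θ hP g₀ os).W K + (cr F θ hP g₀ os).Wsh K < 1)
    (hedge : ∀ (F : T4Family) (θ : Stage11Params F N) (hP : θ.Provisos₁₁), θ.Admissible → ∀ (g₀ : ℕ → ℝ) (os : List (ULoop F)),
      Inputs F (datumOfRecord₁₁ F N θ hP) g₀ os → letI := (cr F θ hP g₀ os).dec
      ∃ δ : ℕ → ℝ, NE7.Core (cr F θ hP g₀ os).l₀ (cr F θ hP g₀ os).vol (cr F θ hP g₀ os).T (cr F θ hP g₀ os).Bad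
        (fun K t τ => (cr F θ hP g₀ os).A K t τ - (cr F θ hP g₀ os).shA K t τ)
        (fun K t τ => (cr F θ hP g₀ os).B K t τ - (cr F θ hP g₀ os).shB K t τ) δ ∧ Summable δ)
    {F : T4Family} {D : Datum F N} {w : DagBinding.WorldP} (hR : IsRecordOfRecord₁₁C F N D w)
    (hB : B16.EndStatementBPrinted D.C) (hE : DagBinding.EndpointExistence D.C.toB12) :
    ForSmallCouplings D fun g₀ => ∀ os : List (ULoop F), Inputs F D g₀ os →
      ∃ (l₀ vol : ℝ) (δ' : ℕ → ℝ), 0 < l₀ ∧ Summable δ' ∧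
        MatchingModConstants vol l₀ δ' (T4GenFunBounds.schemeZ (D.scheme g₀) os) :=
  matching_at_record₁₁_of_coreEdge (SRec₁₁ cr) Inputs hx h20 h21 ((lt_one_sRec₁₁_iff cr).mpr hlt)
    ((coreEdge_sRec₁₁_iff cr Inputs).mpr hedge) hR hB hE

/-- **… K4's HOOK CONSUMED, IN THE NAME `T4ApexVariance.MatchingUnder D END`** [bookkeeping] — ONE application of module 1's
`stringwiseMatching_at_record₁₁_of_spineRates` at `SRec₁₁ cr`: with `SpineRates ₁₁C Inputs`, node U5's per-string output holds under the prefix at every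
₁₁ record (`MatchingUnder` is `D.UnderHypotheses END (g₀ ↦ StringwiseMatching (D.scheme g₀))`, definitionally). [folklore] -/
theorem matchingUnder_at_record₁₁_sRec₁₁_of_spineRates
    (hx : S_N27x (fun F D w => IsRecordOfRecord₁₁C F N D w) (SRec₁₁ cr)) (h20 : S_N20 (SRec₁₁ cr)) (h21 : S_N21 (SRec₁₁ cr))
    (hlt : ∀ (F : T4Family) (θ : Stage11Params F N) (hP : θ.Provisos₁₁), θ.Admissible → ∀ (g₀ : ℕ → ℝ) (os : List (ULoop F)) (K : ℕ),
      (cr F θ hP g₀ os).W K + (cr F θ hP g₀ os).Wsh K < 1)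
    (hedge : ∀ (F : T4Family) (θ : Stage11Params F N) (hP : θ.Provisos₁₁), θ.Admissible → ∀ (g₀ : ℕ → ℝ) (os : List (ULoop F)),
      Inputs F (datumOfRecord₁₁ F N θ hP) g₀ os → letI := (cr F θ hP g₀ os).dec
      ∃ δ : ℕ → ℝ, NE7.Core (cr F θ hP g₀ os).l₀ (cr F θ hP g₀ os).vol (cr F θ hP g₀ os).T (cr F θ hP g₀ os).Bad
        (fun K t τ => (cr F θ hP g₀ os).A K t τ - (cr F θ hP g₀ os).shA K t τ)
        (fun K t τ => (cr F θ hP g₀ os).B K t τ - (cr F θ hP g₀ os).shB K t τ) δ ∧ Summable δ)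
    (h4 : SpineRates (fun F D w => IsRecordOfRecord₁₁C F N D w) Inputs)
    {F : T4Family} {D : Datum F N} {w : DagBinding.WorldP} (hR : IsRecordOfRecord₁₁C F N D w) :
    MatchingUnder D (DagBinding.EndpointExistence D.C.toB12) :=
  stringwiseMatching_at_record₁₁_of_spineRates (SRec₁₁ cr) Inputs hx h20 h21 ((lt_one_sRec₁₁_iff cr).mpr hlt)
    ((coreEdge_sRec₁₁_iff cr Inputs).mpr hedge) h4 hR

/-- **… BY NAME FROM THE RATE STUBS AT A PARAMETRIC RATE-CARRIER PREDICATE `RRec`, U4′'s BUDGET HALF NOT NEEDED** [bookkeeping]: module 2's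
`S_R00x ₁₁C RRec` · `S_N14` … `S_N22` at `RRec` (all six in-edges BY NAME), the sibling stubs at `SRec₁₁ cr`, and N19's rate edge KEYED at the tuples OVER
`RRec` (§1 `rateEdge_sRec₁₁_iff`: every `R` that `RRec` pins at θ's datum with `RatesAt`) ⇒ `MatchingUnder D END` at every ₁₁ record — n27-a XIV
`spine_of_rateStubs_coreEdge` at `SRec₁₁ cr` (B5 at ₁₁C; no `hlt`, no `S.δ`: the budget half is a tail property), then node U5 under the prefix at the
record (`T4MatchingDegenerate.hybridNE7Under_iff_matchingUnder`, `AvgMeasurable` from the record).  `RRec` stays a PARAMETER until the (T-RATE) layer of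
the home lands; the literal `HybridNE7.lt_one`-filling variant is module 1's `stringwiseMatching_at_record₁₁_of_rateStubs` at `SRec₁₁ cr` with §1's faces.
[folklore] -/
theorem matchingUnder_at_record₁₁_sRec₁₁_of_rateStubs_tail
    (hxR : S_R00x (fun F D w => IsRecordOfRecord₁₁C F N D w) RRec) (h14 : S_N14 RRec) (h15 : S_N15 RRec) (h16 : S_N16 RRec)
    (h17 : S_N17 RRec) (h18 : S_N18 RRec) (h22 : S_N22 RRec)
    (hx : S_N27x (fun F D w => IsRecordOfRecord₁₁C F N D w) (SRec₁₁ cr)) (h20 : S_N20 (SRec₁₁ cr)) (h21 : S_N21 (SRec₁₁ cr))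
    (hedgeR : ∀ (F : T4Family) (θ : Stage11Params F N) (hP : θ.Provisos₁₁), θ.Admissible → ∀ (g₀ : ℕ → ℝ) (os : List (ULoop F))
      (R : RateCarriers N), RRec F (datumOfRecord₁₁ F N θ hP) g₀ os R → RatesAt (datumOfRecord₁₁ F N θ hP) R →
      letI := (cr F θ hP g₀ os).dec
      ∃ δ : ℕ → ℝ, NE7.Core (cr F θ hP g₀ os).l₀ (cr F θ hP g₀ os).vol (cr F θ hP g₀ os).T (cr F θ hP g₀ os).Bad
        (fun K t τ => (cr F θ hP g₀ os).A K t τ - (cr F θ hP g₀ os).shA K t τ)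
        (fun K t τ => (cr F θ hP g₀ os).B K t τ - (cr F θ hP g₀ os).shB K t τ) δ ∧ Summable δ)
    {F : T4Family} {D : Datum F N} {w : DagBinding.WorldP} (hR : IsRecordOfRecord₁₁C F N D w) :
    MatchingUnder D (DagBinding.EndpointExistence D.C.toB12) :=
  (T4MatchingDegenerate.hybridNE7Under_iff_matchingUnder D (avgMeasurable_of_isRecordOfRecord₁₁C hR) _).mp
    (spine_of_rateStubs_coreEdge (fun F D w => IsRecordOfRecord₁₁C F N D w) (SRec₁₁ cr) RRec hxR h14 h15 h16 h17 h18 h22 hx h20 h21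
      ((rateEdge_sRec₁₁_iff cr RRec).mpr hedgeR) F D w hR)

end Target

/-! ## §3 The budget road at the home (module 3 BY NAME): the per-term budget on the margin window READ AT THE TUPLES -/

section Budget

variable (Inputs : InputsPred N)
/-- **THE BUDGET ROAD AT THE HOME, K4 CONSUMED** [bookkeeping] — ONE application of module 3's `matchingUnder_at_record₁₁_of_termBudgetReading` at
`SRec₁₁ cr`: the sibling stubs at `SRec₁₁ cr`, the keyed budget half, and a TERM-BUDGET READING KEYED AT THE TUPLES — «for every admissible θ with provisos,
every `g₀`, `os`: `Inputs` at the datum hands the DISPLAYED per-term budget `T4GoodClassBudget.TermBudget` on the shell-free cores of `cr F θ hP g₀ os` with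
the window rate `r_K = max(Cw,1)(E₀(K+1)^m + Cr)Σ_{j+n=K} min(aⁿ, θ′^jΛⁿ) + rO_K`, centre deviations `s` and the window's numerics» — give, with K4's hook,
`MatchingUnder D END` at every ₁₁ record (`Σ δ_K < ∞` PROVED from the window inside module 3; the budget reading is the hypothesis). [folklore] -/
theorem matchingUnder_at_record₁₁_sRec₁₁_of_termBudget
    (hx : S_N27x (fun F D w => IsRecordOfRecord₁₁C F N D w) (SRec₁₁ cr)) (h20 : S_N20 (SRec₁₁ cr)) (h21 : S_N21 (SRec₁₁ cr))
    (hlt : ∀ (F : T4Family) (θ : Stage11Params F N) (hP : θ.Provisos₁₁), θ.Admissible → ∀ (g₀ : ℕ → ℝ) (os : List (ULoop F)) (K : ℕ),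
      (cr F θ hP g₀ os).W K + (cr F θ hP g₀ os).Wsh K < 1)
    (hbud : ∀ (F : T4Family) (θ : Stage11Params F N) (hP : θ.Provisos₁₁), θ.Admissible → ∀ (g₀ : ℕ → ℝ) (os : List (ULoop F)),
      Inputs F (datumOfRecord₁₁ F N θ hP) g₀ os → letI := (cr F θ hP g₀ os).dec
      ∃ (Cc Rr : ℕ → ℝ → (cr F θ hP g₀ os).ι → ℝ) (c₀ rO s : ℕ → ℝ) (Cw E₀ Cr a θ' Λg : ℝ) (m : ℕ),
        TermBudget (cr F θ hP g₀ os).l₀ (cr F θ hP g₀ os).vol (cr F θ hP g₀ os).T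
          (fun K t τ => (cr F θ hP g₀ os).A K t τ - (cr F θ hP g₀ os).shA K t τ)
          (fun K t τ => (cr F θ hP g₀ os).B K t τ - (cr F θ hP g₀ os).shB K t τ) (cr F θ hP g₀ os).Bad Cc Rr c₀
          (fun K : ℕ => max Cw 1 * ((E₀ * ((K : ℝ) + 1) ^ m + Cr) * ∑ x ∈ antidiagonal K, min (a ^ x.2) (θ' ^ x.1 * Λg ^ x.2)) + rO K)
          s ∧
        0 ≤ E₀ ∧ 0 ≤ Cr ∧ 0 < a ∧ a < 1 ∧ 0 < θ' ∧ θ' < 1 ∧ θ' ≤ Λg ∧ Summable rO ∧ Summable s)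
    (h4 : SpineRates (fun F D w => IsRecordOfRecord₁₁C F N D w) Inputs)
    {F : T4Family} {D : Datum F N} {w : DagBinding.WorldP} (hR : IsRecordOfRecord₁₁C F N D w) :
    MatchingUnder D (DagBinding.EndpointExistence D.C.toB12) :=
  matchingUnder_at_record₁₁_of_termBudgetReading (SRec₁₁ cr) Inputs hx h20 h21 ((lt_one_sRec₁₁_iff cr).mpr hlt)
    (by
      rintro F D g₀ os S ⟨θ, hP, hθ, rfl, rfl⟩ hI
      exact hbud F θ hP hθ g₀ os hI)
    h4 hR

end Budget

end Summit.QuantumFields.YangMills.BalabanUVNodes.N19TargetAtRecord11Home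

end
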